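import Summits.BirchSwinnertonDyer.BirchSwinnertonDyer.Theorems.PrintCf2RubinValueTwoLeopoldtAtV
import Literature.NumberTheory.Transcendental.BrumerPadicBakerProofs
import HarnessLib

/-!
# The `𝔭`-adic Leopoldt theorem for abelian extensions of an imaginary quadratic field —
# UNCONDITIONAL forms (Brumer's theorem discharged by the tree's `brumer1967_thm1_holds`)

Cell `bsd-print-cf2`, crux `PrintCf2RubinValueTwo.TwoVariableMainConjAtSplitTwo`
(stmt-BirchSwinnertonDyer-23720), brick (b) «weak Leopoldt over `𝔎_∞`: `Ē_∞ ↪ U_v`» of LEAD ruling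
B23 §4.  The theorems of `PrintCf2RubinValueTwoLeopoldtAtV.lean` take Brumer's `p`-adic Baker theorem
as the hypothesis `hB : brumer1967_thm1 p`; the tree PROVES it
(`Literature.NumberTheory.Transcendental.brumer1967_thm1_holds`, module
`Transcendental/BrumerPadicBakerProofs`), so here are the unconditional one-line corollaries, for
every prime `p` (in particular `p = 2`) and every embedding `τ : F →+* ℚ̄_p`:

* `finrank_span_padicLog_units_eq_rank` — (T-rank) `dim_{ℚ̄_p} span{(log_p τ(σu))_σ : u ∈ 𝓞_Fˣ} =
  rank 𝓞_Fˣ` for `K` imaginary quadratic, `F/K` finite abelian;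
* `linearIndependent_padicLog_fundSystem_holds` — (T-reg) the `𝔭`-adic regulator vectors of
  Mathlib's fundamental system of units are `ℚ̄_p`-linearly independent.

`--supports` 23720 (helper); nothing here closes the crux; BSD is not proved by any of this.

References: E. de Shalit (1987) III.2.3 "THEOREM (BAKER–BRUMER). `R_𝔭(E) ≠ 0`"; A. Brumer,
Mathematika 14 (1967) Thm. 1; L. C. Washington, GTM 83, Thm. 5.25.
-/

noncomputable section

set_option linter.dupNamespace false -- `Summit.BirchSwinnertonDyer.BirchSwinnertonDyer` (summit = problem) is the tree's layout
set_option autoImplicit false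

open NumberField Module Submodule
open Literature.NumberTheory.EllipticCurves Literature.NumberTheory.Transcendental

namespace Summit.BirchSwinnertonDyer.BirchSwinnertonDyer.Theorems.PrintCf2.LeopoldtAtV

variable {p : ℕ} [Fact p.Prime]
variable {K : Type} [Field K] [NumberField K] {F : Type} [Field F] [NumberField F] [Algebra K F]

/-- **(T-rank), unconditional: the `𝔭`-adic rank of the units of an abelian extension of an imaginary
quadratic field equals their archimedean rank** (de Shalit 1987 III.2.3, Baker–Brumer; any `p`,
any embedding `τ`). [cite: deShalit1987, III.2.3 (Theorem (Baker–Brumer))] [cite: Brumer1967, Thm. 1] -/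
theorem finrank_span_padicLog_units_eq_rank (hK : IsImaginaryQuadratic K) [IsAbelianGalois K F]
    (τ : F →+* PadicAlgCl p) :
    finrank (PadicAlgCl p) (span (PadicAlgCl p) (Set.range (fun u : (𝓞 F)ˣ ↦
      fun σ : F ≃ₐ[K] F ↦ padicLogAlgCl p (τ (σ (algebraMap (𝓞 F) F (u : 𝓞 F))))))) =
    Units.rank F :=
  finrank_span_padicLog_units (brumer1967_thm1_holds p) hK τ

/-- **(T-reg), unconditional: the `𝔭`-adic regulator of an abelian extension of an imaginary quadratic
field does not vanish** — `(log_p τ(σ u_i))_σ`, `u_i = fundSystem F i`, are `ℚ̄_p`-linearly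
independent (de Shalit 1987 III.2.3 "THEOREM (BAKER–BRUMER). `R_𝔭(E) ≠ 0`"; any `p`, any `τ`).
[cite: deShalit1987, III.2.3 (Theorem (Baker–Brumer))] [cite: Brumer1967, Thm. 1] -/
theorem linearIndependent_padicLog_fundSystem_holds (hK : IsImaginaryQuadratic K)
    [IsAbelianGalois K F] (τ : F →+* PadicAlgCl p) :
    LinearIndependent (PadicAlgCl p) (fun i : Fin (Units.rank F) ↦ fun σ : F ≃ₐ[K] F ↦
      padicLogAlgCl p (τ (σ (algebraMap (𝓞 F) F (Units.fundSystem F i : 𝓞 F))))) :=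
  linearIndependent_padicLog_fundSystem (brumer1967_thm1_holds p) hK τ

/-- **CORE, unconditional**: for the Minkowski unit `ε` (file 1) the vectors `(log_p τ(σρε))_σ`,
`ρ ≠ 1`, are `ℚ̄_p`-linearly independent. [cite: deShalit1987, III.2.3 (Theorem (Baker–Brumer))] -/
theorem linearIndependent_padicLog_conj_of_minkowski_holds (hK : IsImaginaryQuadratic K)
    [IsAbelianGalois K F] (τ : F →+* PadicAlgCl p) {w₀ : InfinitePlace F} {ε : (𝓞 F)ˣ}
    (hε : ∀ ρ : F ≃ₐ[K] F, ρ ≠ 1 → Real.log (w₀ (ρ (algebraMap (𝓞 F) F (ε : 𝓞 F)))) < 0) :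
    LinearIndependent (PadicAlgCl p) (fun ρ : {ρ : F ≃ₐ[K] F // ρ ≠ 1} ↦ fun σ : F ≃ₐ[K] F ↦
      padicLogAlgCl p (τ (σ ((ρ : F ≃ₐ[K] F) (algebraMap (𝓞 F) F (ε : 𝓞 F)))))) :=
  linearIndependent_padicLog_conj_of_minkowski (brumer1967_thm1_holds p) hK τ hε

end Summit.BirchSwinnertonDyer.BirchSwinnertonDyer.Theorems.PrintCf2.LeopoldtAtV

end
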